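import Summits.ABC.IUTFork.Cor312PrArchShift
import HarnessLib

/-!
# [IUTchIII] Corollary 3.12, honest archimedean place: the Step (vii) container MODEL is EXTREMAL — every Θ-box family inside
# print's container `π^{j+1}·B_I` gives `−|log(Θ)| ≤` that of the fourth corner; so the fourth corner's NEGATIVE results hold
# for all such models

PROOF-ONLY record file (D-0012; no definitions, no `Prop` facts) of the abc-iut cell (wave-5 prover seat abc-iut-w5-d163, gen 3;
sequel of `Cor312PrArchShift`); TAKES NO SIDE on [IUTchIII] Cor. 3.12.

The fourth corner `Real.settingPrVolArchSharp` (abc-iut-c312-7 over this seat's `settingPrVolArch`) takes as Θ-boxes at `∞` the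
[IUTchIV] Thm. 1.10 Step (vii) CONTAINER `π^{j+1}·B_I` itself — print states it as an UPPER BOUND ("serves as a container for the
union of possible images", p. 30). THIS FILE removes the dependence on that modelling choice for every statement that bounds
`−|log(Θ)|` from ABOVE: for ANY Θ-box family `thetaBox` of this seat's per-frame real setting `settingPrVolArch` which
(a) agrees with the sharp idele boxes at every prime (as `(Ind3)`-unions), (b) lies inside the container at `∞` and (c) is
nondegenerate there (some point with each coordinate non-zero — else the printed hull does not exist and `−|log(Θ)| = +∞`):

* §1 `Cor312.Setting.thetaLocal_congr_at` — `thetaLocal (j, v_ℚ)` depends only on the column, the frame and the (Ind3)-region; hence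
  (`thetaLocal_settingPrVolArch_inr_eq_sharp`) such a family has the fourth corner's local Θ-volumes at every prime;
* §2 **`thetaLocal_settingPrVolArch_inl_le`** — at `∞` its local Θ-volume is `≤ |S^±_{j+1}|·log π` (hull minimality in the real frame:
  the (Ind1)/(Ind2)-orbit of boxes inside `π^{j+1}·B_I` stays inside, this seat's `family_image_ballPk`; monotone volumes);
* §3 **`statement_settingPrVolArchSharp_of_statement_boxes`** — `Statement(thetaBox-setting) ⟹ Statement(fourth corner)`
  (`−|log(q)|` is the same number, `−|log(Θ)|` can only grow); contrapositively (`not_statement_boxes_of_not_statement_settingPrVolArchSharp`)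
  every NEGATIVE result at the fourth corner — deep `q`-ideles (`settingPrVolArchSharp_not_statement_of_deep_ideles`), the realising
  Szpiro bound (`Cor312PrArchShiftSzpiro`) — holds for EVERY honest-`∞` box model inside print's container; and
  (`statement_boxes_iff_settingPrVolArchSharp`, v2) if the boxes moreover CONTAIN `Φ₀(⊗_i (π)_v)` (print: the possible images contain
  the tensors of log-shell elements) the typed `Statement`s are EQUIVALENT — the fourth corner represents every faithful model.

NEUTRAL READING: among honest archimedean models whose Θ-images sit inside print's Step (vii) container, the fourth corner is the
most generous to the Corollary; its failures are therefore model-independent at `∞`, its successes (shallow regime) are not claimed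
to be. HONEST FRAMING: statements about the tree's typed settings; no side taken; nothing asserts abc. typed ≠ proved;
instantiated ≠ endorsed. [cite: Mochizuki2012, IUTchIV Thm 1.10 proof Step (vii) p. 30]; [cite: DupuyHilado2025, §3.3, §4.10].
-/

noncomputable section

open Set Function NumberField IsDedekindDomain
open scoped Pointwise

namespace Summit.ABC

namespace IUTFork

/-! ## §1. `thetaLocal` depends only on the column, the frame and the (Ind3)-region -/

namespace Cor312.Setting

variable {T : Thm311.ThetaIndex} {S : Thm311.Situation T}

/-- **Congruence for the local Θ-volume**: two settings over the same situation with the same column, the same real frame at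
`(j, v_ℚ)` and the same (Ind3)-enlarged region at `(j, v_ℚ)` have the same possible images, hull and `thetaLocal` there (the
(Ind1)/(Ind2) group is the situation's). [folklore] -/
theorem thetaLocal_congr_at {P P' : Setting S} (j : T.Label) (vQ : T.VQ) (hn : P.n = P'.n)
    (hf : P.frame j vQ = P'.frame j vQ) (h3 : P.thetaRegion3 j vQ = P'.thetaRegion3 j vQ) :
    P.thetaLocal j vQ = P'.thetaLocal j vQ := by
  have hpi : P.possibleImages j vQ = P'.possibleImages j vQ := by
    ext U
    simp only [Setting.possibleImages, Set.mem_setOf_eq, h3]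
  unfold Setting.thetaLocal Setting.HullDefined Setting.thetaHull
  rw [hpi, hf, hn]

end Cor312.Setting

namespace Thm311

namespace Real

open Cor312 Cor312.Setting Cor312Vol Literature.IUT.LogThetaLattice Literature.IUT.LogVolume

variable {F : Type} [Field F] [NumberField F] (X : PilotData F) {logv : PadicLogs F} (hlog : LogvAnalytic logv)
  (hc : ∀ w : InfinitePlace F, w.IsComplex) (M : Type) [Field M] [NumberField M]
  (archPk : ∀ (j : (thetaIndex X).Label) (vQ : (thetaIndex X).VQ), Set ((logShellsDH X logv).Packet j vQ))
  (archSub : ∀ (j : (thetaIndex X).Label) (v : (thetaIndex X).V),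
    Set ((logShellsDH X logv).Packet j ((thetaIndex X).over v)))
  (Ψ : ℤ → ∀ v : (thetaIndex X).V, v ∈ (thetaIndex X).Vbad → Set ((logShellsDH X logv).StarPacket v))
  (act : ℤ → ∀ v : (thetaIndex X).V, v ∈ (thetaIndex X).Vbad →
    (logShellsDH X logv).StarPacket v → Module.End ℚ ((logShellsDH X logv).StarPacket v))
  (Mmod : ℤ → ∀ j : (thetaIndex X).LabelStar, Set ((logShellsDH X logv).GlobalPacket j.1))
  (region : ℤ → ∀ j : (thetaIndex X).LabelStar, FinDivisor M → ∀ vQ : (thetaIndex X).VQ,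
    Set ((logShellsDH X logv).Packet j.1 vQ))
  (n : ℤ) {HT : Type} {LogLink : HT → HT → Type} {IsFull : ∀ {s t : HT}, LogLink s t → Prop}
  (lat : LGPGaussianLogThetaLattice LogLink IsFull)
  {Frd : Type} {IsoF : Frd → Frd → Type} {Ob : Frd → Type} {realify : Frd → Frd} {Strip : Type}
  {IsoS : Strip → Strip → Type} {Mv : ∀ v : (thetaIndex X).V, v ∈ (thetaIndex X).Vbad → Type}
  [∀ v h, Monoid (Mv v h)]
  (sig : GlobalLGPFrobenioidSignature (thetaIndex X).lstar (thetaIndex X).V (· ∈ (thetaIndex X).Vbad)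
    Frd IsoF Ob realify Strip IsoS Mv)
  (split : SplittingMonoids Mv) {ObΔ : Type} {N : ∀ v : (thetaIndex X).V, v ∈ (thetaIndex X).Vbad → Type}
  [∀ v h, Monoid (N v h)] (qData : QPilotData ObΔ N)
  (thetaBox : ℤ → Ob sig.Clgp → ∀ (j : (thetaIndex X).Label) (vQ : (thetaIndex X).VQ),
    Set (∀ s : factorIdxDHArch X hlog j vQ, factorFieldDHArch X hlog j vQ s))
  (qCentre : ObΔ → ∀ (j : (thetaIndex X).Label) (vQ : (thetaIndex X).VQ),
    ∀ s : factorIdxDHArch X hlog j vQ, factorFieldDHArch X hlog j vQ s)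
  (hq : ∀ j vQ s, qCentre (qPilotObject qData) j vQ s ≠ 0)
  (hfin : ∀ j : (thetaIndex X).Label, (Function.support fun vQ =>
    ((situationDHVolPrArch X hlog hc M archPk archSub Ψ act Mmod region).D n).logvol j vQ
      (factorMapDHArch X hlog hc j vQ ⁻¹' hullSet (factorFieldDHArch X hlog j vQ)
        (qCentre (qPilotObject qData) j vQ))).Finite)

/-! ## §2. At `∞`: any box family inside the container has local Θ-volume `≤ |S^±_{j+1}|·log π` -/

/-- **The Step (vii) container bounds every honest model from above**: if the (Ind3)-union of the Θ-boxes at `(j, ∞)`,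
`j ∈ 𝔽_l^⋇`, lies inside `π^{j+1}·B_I` (in the field-factor coordinates: `archContainer`) and is nondegenerate, then `HullDefined`
holds there and `thetaLocal (j, ∞) ≤ |S^±_{j+1}|·log π` — the whole (Ind1)/(Ind2)-orbit stays in `e⁻¹(π^{j+1}·B_I)` (this seat's
`family_image_ballPk`), a hull-set of the real frame, so the hull does too (hull minimality), and volumes are monotone.
[cite: Mochizuki2012, IUTchIV Thm 1.10 proof Step (vii) p. 30] [claim: Mochizuki2012, status: disputed] -/
theorem thetaLocal_settingPrVolArch_inl_le (i : Fin (thetaIndex X).lstar)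
    (hsub : (⋃ m : ℤ, thetaBox m (thetaPilotObject sig split) (labelSucc i) (.inl ())) ⊆
      archContainer X hlog (labelSucc i))
    (hnd : IsNondegenerate (factorFieldDHArch X hlog (labelSucc i) (.inl ()))
      (⋃ m : ℤ, thetaBox m (thetaPilotObject sig split) (labelSucc i) (.inl ()))) :
    (settingPrVolArch X hlog hc M archPk archSub Ψ act Mmod region n lat sig split qData thetaBox qCentre hq
        hfin).thetaLocal (labelSucc i) (.inl ()) ≤
      ((Fintype.card ((thetaIndex X).Caps (labelSucc i)) * Real.log Real.pi : ℝ) : WithTop ℝ) := by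
  have hD : (settingPrVolArch X hlog hc M archPk archSub Ψ act Mmod region n lat sig split qData thetaBox qCentre hq
      hfin).HullDefined (labelSucc i) (.inl ()) :=
    hullDefined_settingPrVolArch_inl X hlog hc M archPk archSub Ψ act Mmod region n lat sig split qData thetaBox qCentre
      hq hfin (labelSucc i) ((isBounded_polydisc _ _).subset hsub) hnd
  have hr0 : (0 : ℝ) ≤ Real.pi ^ Fintype.card ((thetaIndex X).Caps (labelSucc i)) := (pow_pos Real.pi_pos _).le
  -- `W := e⁻¹(π^{j+1}·B_I)` is the preimage of the container under the field-factor comparison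
  have hWeq : (archPresentationDH X logv hc).ballPk (labelSucc i) (Real.pi ^ Fintype.card ((thetaIndex X).Caps (labelSucc i))) =
      factorMapDHArch X hlog hc (labelSucc i) (.inl ()) ⁻¹' archContainer X hlog (labelSucc i) := by
    rw [(archPresentationDH X logv hc).ballPk_eq_preimage_polydisc (labelSucc i) hr0,
      ← archContainer_eq_archPacket X hlog (labelSucc i), factorMapDHArch_inl]
    rfl
  -- the (Ind3)-region and then every possible image lie in `W`
  have h3 : (settingPrVolArch X hlog hc M archPk archSub Ψ act Mmod region n lat sig split qData thetaBox qCentre hq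
      hfin).thetaRegion3 (labelSucc i) (.inl ()) ⊆
      (archPresentationDH X logv hc).ballPk (labelSucc i) (Real.pi ^ Fintype.card ((thetaIndex X).Caps (labelSucc i))) := by
    rw [hWeq, thetaRegion3_settingPrVolArch]
    exact Set.preimage_mono hsub
  have hU : ⋃₀ (settingPrVolArch X hlog hc M archPk archSub Ψ act Mmod region n lat sig split qData thetaBox qCentre hq
      hfin).possibleImages (labelSucc i) (.inl ()) ⊆
      (archPresentationDH X logv hc).ballPk (labelSucc i) (Real.pi ^ Fintype.card ((thetaIndex X).Caps (labelSucc i))) :=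
    (settingPrVolArch X hlog hc M archPk archSub Ψ act Mmod region n lat sig split qData thetaBox qCentre hq
      hfin).sUnion_possibleImages_subset
      (fun Φ hΦ => (archPresentationDH X logv hc).family_image_ballPk hΦ (labelSucc i) _) h3
  -- `W` is a hull-set of the real frame at `(j, ∞)` (the container is `λ·𝒪` with `λ = Φ₀(⊗_i (π)_v)`)
  have hHS : IsHullSet (factorFieldDHArch X hlog (labelSucc i) (.inl ())) (archContainer X hlog (labelSucc i)) :=
    ⟨archMaxPoint X hlog (labelSucc i), fun s => by
      rw [← norm_ne_zero_iff, norm_archMaxPoint]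
      exact (pow_pos Real.pi_pos _).ne', archContainer_eq_hullSet X hlog (labelSucc i)⟩
  have hWmem : (archPresentationDH X logv hc).ballPk (labelSucc i) (Real.pi ^ Fintype.card ((thetaIndex X).Caps (labelSucc i))) ∈
      ((settingPrVolArch X hlog hc M archPk archSub Ψ act Mmod region n lat sig split qData thetaBox qCentre hq
        hfin).frame (labelSucc i) (.inl ())).Hul := by
    rw [hWeq]
    exact ⟨archContainer X hlog (labelSucc i), (frameKDHArch_hul_iff X hlog (labelSucc i) (.inl ()) _).mpr hHS, rfl⟩
  have hhull : (settingPrVolArch X hlog hc M archPk archSub Ψ act Mmod region n lat sig split qData thetaBox qCentre hq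
      hfin).thetaHull (labelSucc i) (.inl ()) ⊆
      (archPresentationDH X logv hc).ballPk (labelSucc i) (Real.pi ^ Fintype.card ((thetaIndex X).Caps (labelSucc i))) :=
    HullFrame.hull_subset_of_mem _ hWmem hU
  -- volumes: the hull is admissible, `W` is admissible of log-volume `|S^±_{j+1}|·log π`, volumes are monotone
  have hadmH := (settingPrVolArch X hlog hc M archPk archSub Ψ act Mmod region n lat sig split qData thetaBox qCentre hq
    hfin).thetaHull_adm hD
  have hadmW : ((situationDHVolPrArch X hlog hc M archPk archSub Ψ act Mmod region).D n).Adm (labelSucc i) (.inl ())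
      ((archPresentationDH X logv hc).ballPk (labelSucc i) (Real.pi ^ Fintype.card ((thetaIndex X).Caps (labelSucc i)))) := by
    rw [hWeq]
    exact hadm_PrArch X hlog hc M archPk archSub Ψ act Mmod region n (labelSucc i) (.inl ()) _ hHS
  have hvolW : ((situationDHVolPrArch X hlog hc M archPk archSub Ψ act Mmod region).D n).logvol (labelSucc i) (.inl ())
      ((archPresentationDH X logv hc).ballPk (labelSucc i) (Real.pi ^ Fintype.card ((thetaIndex X).Caps (labelSucc i)))) =
      Fintype.card ((thetaIndex X).Caps (labelSucc i)) * Real.log Real.pi :=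
    logvol_thetaContainer_prArch X hlog hc (labelSucc i)
  have hmono := logvolMono_settingPrVolArch X hlog hc M archPk archSub Ψ act Mmod region n lat sig split qData thetaBox
    qCentre hq hfin
  unfold Setting.thetaLocal
  rw [if_pos hD, WithTop.coe_le_coe, ← hvolW]
  exact hmono i (.inl ()) hadmH hadmW hhull

/-! ## §3. Comparison with the fourth corner: same primes, smaller `∞` ⟹ `Statement` transfers TO the fourth corner -/

variable (t : ∀ (pp : Nat.Primes) (_ : Fin X.lstar) (x : (thetaIndex X).Fibre (.inr pp)),
    haveI : Fact (pp : ℕ).Prime := ⟨pp.2⟩; kOf X pp.1 x)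
  (tq : ∀ (pp : Nat.Primes) (x : (thetaIndex X).Fibre (.inr pp)), haveI : Fact (pp : ℕ).Prime := ⟨pp.2⟩; kOf X pp.1 x)
  (htq0 : ∀ pp x, tq pp x ≠ 0)
  (htq1 : ∀ (pp : Nat.Primes) (x : (thetaIndex X).Fibre (.inr pp)),
    haveI : Fact (pp : ℕ).Prime := ⟨pp.2⟩; placeOf X pp.1 x ∉ X.S → ‖tq pp x‖ = 1)

/-- **At a prime, a box family with the sharp (Ind3)-unions has the fourth corner's local Θ-volume** (§1 congruence: same column,
same frame, same (Ind3)-region; the `q`-data being abc-iut-c312-7's `qCentreDHArch tq`). [claim: Mochizuki2012, status: disputed] -/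
theorem thetaLocal_settingPrVolArch_inr_eq_sharp (j : (thetaIndex X).Label) (pp : Nat.Primes)
    (hBp : (⋃ m : ℤ, thetaBox m (thetaPilotObject sig split) j (.inr pp)) = thetaBoxDHArchSharp X hlog t j (.inr pp)) :
    (settingPrVolArch X hlog hc M archPk archSub Ψ act Mmod region n lat sig split qData thetaBox
        (fun _ => qCentreDHArch X hlog tq) (qCentreDHArch_ne_zero X hlog tq htq0)
        (finite_support_logvol_qRegion_PrArch X hlog hc tq M archPk archSub Ψ act Mmod region n htq0 htq1)).thetaLocal j
        (.inr pp) =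
      (settingPrVolArchSharp X hlog hc M archPk archSub Ψ act Mmod region n lat sig split qData t tq htq0 htq1).thetaLocal j
        (.inr pp) := by
  refine Cor312.Setting.thetaLocal_congr_at j (.inr pp) rfl rfl ?_
  rw [thetaRegion3_settingPrVolArch, hBp]
  show _ = (settingPrVolArch X hlog hc M archPk archSub Ψ act Mmod region n lat sig split qData
    (fun _ _ => thetaBoxDHArchSharp X hlog t) (fun _ => qCentreDHArch X hlog tq) (qCentreDHArch_ne_zero X hlog tq htq0)
    (finite_support_logvol_qRegion_PrArch X hlog hc tq M archPk archSub Ψ act Mmod region n htq0 htq1)).thetaRegion3 j (.inr pp)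
  rw [thetaRegion3_settingPrVolArch, Set.iUnion_const]

/-- **THE FOURTH CORNER IS EXTREMAL AMONG HONEST-`∞` MODELS INSIDE PRINT'S CONTAINER**: for every Θ-box family of this seat's
per-frame real setting that has the sharp idele boxes' (Ind3)-unions at the primes, and at every `(j ∈ 𝔽_l^⋇, ∞)` lies inside
`π^{j+1}·B_I` and is nondegenerate, the typed Cor. 3.12 `Statement` of that setting IMPLIES the `Statement` of the fourth corner
`settingPrVolArchSharp` (same `−|log(q)|`; `−|log(Θ)|` is finite for both and pointwise `≤`). [cite: Mochizuki2012, IUTchIV Thm 1.10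
proof Step (vii) p. 30] [claim: Mochizuki2012, status: disputed] -/
theorem statement_settingPrVolArchSharp_of_statement_boxes (ht0 : ∀ pp i x, t pp i x ≠ 0)
    (ht1 : ∀ (pp : Nat.Primes) (i : Fin X.lstar) (x : (thetaIndex X).Fibre (.inr pp)),
      haveI : Fact (pp : ℕ).Prime := ⟨pp.2⟩; placeOf X pp.1 x ∉ X.S → ‖t pp i x‖ = 1)
    (hBp : ∀ (j : (thetaIndex X).Label) (pp : Nat.Primes),
      (⋃ m : ℤ, thetaBox m (thetaPilotObject sig split) j (.inr pp)) = thetaBoxDHArchSharp X hlog t j (.inr pp))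
    (hBsub : ∀ i : Fin (thetaIndex X).lstar,
      (⋃ m : ℤ, thetaBox m (thetaPilotObject sig split) (labelSucc i) (.inl ())) ⊆ archContainer X hlog (labelSucc i))
    (hBnd : ∀ i : Fin (thetaIndex X).lstar, IsNondegenerate (factorFieldDHArch X hlog (labelSucc i) (.inl ()))
      (⋃ m : ℤ, thetaBox m (thetaPilotObject sig split) (labelSucc i) (.inl ())))
    (hst : (settingPrVolArch X hlog hc M archPk archSub Ψ act Mmod region n lat sig split qData thetaBox
        (fun _ => qCentreDHArch X hlog tq) (qCentreDHArch_ne_zero X hlog tq htq0)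
        (finite_support_logvol_qRegion_PrArch X hlog hc tq M archPk archSub Ψ act Mmod region n htq0 htq1)).Statement) :
    (settingPrVolArchSharp X hlog hc M archPk archSub Ψ act Mmod region n lat sig split qData t tq htq0 htq1).Statement := by
  set PB := settingPrVolArch X hlog hc M archPk archSub Ψ act Mmod region n lat sig split qData thetaBox
    (fun _ => qCentreDHArch X hlog tq) (qCentreDHArch_ne_zero X hlog tq htq0)
    (finite_support_logvol_qRegion_PrArch X hlog hc tq M archPk archSub Ψ act Mmod region n htq0 htq1) with hPB
  set P4 := settingPrVolArchSharp X hlog hc M archPk archSub Ψ act Mmod region n lat sig split qData t tq htq0 htq1 with hP4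
  have hfin4 : P4.ThetaFinite :=
    thetaFinite_settingPrVolArchSharp X hlog hc M archPk archSub Ψ act Mmod region n lat sig split qData t tq ht0 ht1 htq0 htq1
  -- the `thetaBox`-setting's `−|log(Θ)|` is finite, since its Statement holds
  have hfinB : PB.ThetaFinite := by
    by_contra h
    apply hst.1
    unfold Setting.negLogTheta
    rw [if_neg h]
  -- pointwise comparison of the real-valued local Θ-volumes at the labels `j ∈ 𝔽_l^⋇`
  have hpt : ∀ (i : Fin (thetaIndex X).lstar) (vQ : (thetaIndex X).VQ),
      (PB.thetaLocal (labelSucc i) vQ).untopD 0 ≤ (P4.thetaLocal (labelSucc i) vQ).untopD 0 := by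
    intro i vQ
    rcases vQ with u | pp
    · cases u
      have hle := thetaLocal_settingPrVolArch_inl_le X hlog hc M archPk archSub Ψ act Mmod region n lat sig split qData
        thetaBox (fun _ => qCentreDHArch X hlog tq) (qCentreDHArch_ne_zero X hlog tq htq0)
        (finite_support_logvol_qRegion_PrArch X hlog hc tq M archPk archSub Ψ act Mmod region n htq0 htq1) i (hBsub i)
        (hBnd i)
      obtain ⟨x, hx⟩ := WithTop.ne_top_iff_exists.mp (hfinB.1 i (.inl ()))
      rw [hP4, thetaLocal_settingPrVolArchSharp_inl, WithTop.untopD_coe, ← hx, WithTop.untopD_coe]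
      rw [← hx] at hle
      exact WithTop.coe_le_coe.mp hle
    · rw [thetaLocal_settingPrVolArch_inr_eq_sharp X hlog hc M archPk archSub Ψ act Mmod region n lat sig split qData thetaBox
        t tq htq0 htq1 (labelSucc i) pp (hBp _ pp)]
  have hΘ : PB.negLogTheta ≤ P4.negLogTheta := by
    unfold Setting.negLogTheta
    rw [if_pos hfinB, if_pos hfin4, WithTop.coe_le_coe]
    exact processionNormalized_mono fun i => finsum_le_finsum' (hfinB.2 i) (hfin4.2 i) fun vQ => hpt i vQ
  refine ⟨?_, ?_⟩
  · unfold Setting.negLogTheta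
    rw [if_pos hfin4]
    exact WithTop.coe_ne_top
  · have hq : P4.negLogQ = PB.negLogQ := rfl
    rw [hq]
    exact hst.2.trans hΘ

/-- **Contrapositive: every NEGATIVE result at the fourth corner holds for every honest-`∞` box model inside print's container**
(e.g. deep `q`-ideles, `settingPrVolArchSharp_not_statement_of_deep_ideles`; the realising Szpiro bound read as a necessary
condition). [cite: Mochizuki2012, IUTchIV Thm 1.10 proof Step (vii) p. 30] [claim: Mochizuki2012, status: disputed] -/
theorem not_statement_boxes_of_not_statement_settingPrVolArchSharp (ht0 : ∀ pp i x, t pp i x ≠ 0)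
    (ht1 : ∀ (pp : Nat.Primes) (i : Fin X.lstar) (x : (thetaIndex X).Fibre (.inr pp)),
      haveI : Fact (pp : ℕ).Prime := ⟨pp.2⟩; placeOf X pp.1 x ∉ X.S → ‖t pp i x‖ = 1)
    (hBp : ∀ (j : (thetaIndex X).Label) (pp : Nat.Primes),
      (⋃ m : ℤ, thetaBox m (thetaPilotObject sig split) j (.inr pp)) = thetaBoxDHArchSharp X hlog t j (.inr pp))
    (hBsub : ∀ i : Fin (thetaIndex X).lstar,
      (⋃ m : ℤ, thetaBox m (thetaPilotObject sig split) (labelSucc i) (.inl ())) ⊆ archContainer X hlog (labelSucc i))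
    (hBnd : ∀ i : Fin (thetaIndex X).lstar, IsNondegenerate (factorFieldDHArch X hlog (labelSucc i) (.inl ()))
      (⋃ m : ℤ, thetaBox m (thetaPilotObject sig split) (labelSucc i) (.inl ())))
    (h4 : ¬ (settingPrVolArchSharp X hlog hc M archPk archSub Ψ act Mmod region n lat sig split qData t tq htq0 htq1).Statement) :
    ¬ (settingPrVolArch X hlog hc M archPk archSub Ψ act Mmod region n lat sig split qData thetaBox
        (fun _ => qCentreDHArch X hlog tq) (qCentreDHArch_ne_zero X hlog tq htq0)
        (finite_support_logvol_qRegion_PrArch X hlog hc tq M archPk archSub Ψ act Mmod region n htq0 htq1)).Statement :=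
  fun hst => h4 (statement_settingPrVolArchSharp_of_statement_boxes X hlog hc M archPk archSub Ψ act Mmod region n lat sig split
    qData thetaBox t tq htq0 htq1 ht0 ht1 hBp hBsub hBnd hst)

/-- **… and REPRESENTATIVE of every FAITHFUL one**: if moreover the Θ-boxes at each `(j ∈ 𝔽_l^⋇, ∞)` CONTAIN the distinguished point
`Φ₀(⊗_i (π)_v)` — print, [IUTchIV] Step (vii) p. 30: the possible images contain "the elements … obtained by forming the tensor product
of elements of the log-shells", whence the hull IS `π^{j+1}·B_I` (this seat's `thetaLocal_settingPrVolArch_inl`) — then the local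
Θ-volumes agree with the fourth corner's at EVERY `(j ∈ 𝔽_l^⋇, v_ℚ)` and the typed `Statement`s are EQUIVALENT: the fourth corner
represents every honest-`∞` box model that is faithful to Step (vii). [cite: Mochizuki2012, IUTchIV Thm 1.10 proof Step (vii) p. 30]
[claim: Mochizuki2012, status: disputed] -/
theorem statement_boxes_iff_settingPrVolArchSharp
    (hBp : ∀ (j : (thetaIndex X).Label) (pp : Nat.Primes),
      (⋃ m : ℤ, thetaBox m (thetaPilotObject sig split) j (.inr pp)) = thetaBoxDHArchSharp X hlog t j (.inr pp))
    (hBsub : ∀ i : Fin (thetaIndex X).lstar,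
      (⋃ m : ℤ, thetaBox m (thetaPilotObject sig split) (labelSucc i) (.inl ())) ⊆ archContainer X hlog (labelSucc i))
    (hBmem : ∀ i : Fin (thetaIndex X).lstar,
      archMaxPoint X hlog (labelSucc i) ∈ ⋃ m : ℤ, thetaBox m (thetaPilotObject sig split) (labelSucc i) (.inl ())) :
    (settingPrVolArch X hlog hc M archPk archSub Ψ act Mmod region n lat sig split qData thetaBox
        (fun _ => qCentreDHArch X hlog tq) (qCentreDHArch_ne_zero X hlog tq htq0)
        (finite_support_logvol_qRegion_PrArch X hlog hc tq M archPk archSub Ψ act Mmod region n htq0 htq1)).Statement ↔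
      (settingPrVolArchSharp X hlog hc M archPk archSub Ψ act Mmod region n lat sig split qData t tq htq0 htq1).Statement := by
  have hloc : ∀ (i : Fin (thetaIndex X).lstar) (vQ : (thetaIndex X).VQ),
      (settingPrVolArch X hlog hc M archPk archSub Ψ act Mmod region n lat sig split qData thetaBox
          (fun _ => qCentreDHArch X hlog tq) (qCentreDHArch_ne_zero X hlog tq htq0)
          (finite_support_logvol_qRegion_PrArch X hlog hc tq M archPk archSub Ψ act Mmod region n htq0 htq1)).thetaLocal
          (labelSucc i) vQ =
        (settingPrVolArchSharp X hlog hc M archPk archSub Ψ act Mmod region n lat sig split qData t tq htq0 htq1).thetaLocal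
          (labelSucc i) vQ := by
    intro i vQ
    rcases vQ with u | pp
    · cases u
      rw [thetaLocal_settingPrVolArch_inl X hlog hc M archPk archSub Ψ act Mmod region n lat sig split qData _ _ _ (labelSucc i)
        (hBsub i) (hBmem i), thetaLocal_settingPrVolArchSharp_inl]
    · exact thetaLocal_settingPrVolArch_inr_eq_sharp X hlog hc M archPk archSub Ψ act Mmod region n lat sig split qData thetaBox
        t tq htq0 htq1 (labelSucc i) pp (hBp _ pp)
  have hfinIff :
      (settingPrVolArch X hlog hc M archPk archSub Ψ act Mmod region n lat sig split qData thetaBox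
          (fun _ => qCentreDHArch X hlog tq) (qCentreDHArch_ne_zero X hlog tq htq0)
          (finite_support_logvol_qRegion_PrArch X hlog hc tq M archPk archSub Ψ act Mmod region n htq0 htq1)).ThetaFinite ↔
        (settingPrVolArchSharp X hlog hc M archPk archSub Ψ act Mmod region n lat sig split qData t tq htq0 htq1).ThetaFinite := by
    unfold Setting.ThetaFinite
    simp only [hloc]
  have hΘ :
      (settingPrVolArch X hlog hc M archPk archSub Ψ act Mmod region n lat sig split qData thetaBox
          (fun _ => qCentreDHArch X hlog tq) (qCentreDHArch_ne_zero X hlog tq htq0)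
          (finite_support_logvol_qRegion_PrArch X hlog hc tq M archPk archSub Ψ act Mmod region n htq0 htq1)).negLogTheta =
        (settingPrVolArchSharp X hlog hc M archPk archSub Ψ act Mmod region n lat sig split qData t tq htq0 htq1).negLogTheta := by
    unfold Setting.negLogTheta
    by_cases hA : (settingPrVolArchSharp X hlog hc M archPk archSub Ψ act Mmod region n lat sig split qData t tq htq0
        htq1).ThetaFinite
    · rw [if_pos hA, if_pos (hfinIff.mpr hA)]
      simp only [hloc]
    · rw [if_neg hA, if_neg (fun h => hA (hfinIff.mp h))]
  unfold Setting.Statement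
  rw [hΘ]
  exact Iff.rfl

end Real

end Thm311

end IUTFork

end Summit.ABC

end
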